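import Mathlib

/-!
# PercRepro — C-025: the arithmetic core of Theorem B′ (p3, gen 6)

Pure binomial arithmetic for mine-2's Theorem B′ (`proofs/MINE2-RLS.md` §13, step (ii), case `r(E) = p`):
with `W j` the rank-`j` level counts of a coloop-free matroid of rank `p₀` on `c′` points and `c₀` further
coloops, the Vandermonde expansion `C(p₀+c₀+1, u)·c′ = Σ_{j ≤ u} C(p₀+1, j)·c′·C(c₀, u−j)` is dominated by
`(p₀+c₀+1)·Σ_{j ≤ u} W j·C(c₀, u−j)` as soon as `(p₀+1)·W j ≥ C(p₀+1, j)·c′` for `1 ≤ j ≤ p₀` (this is (L0)),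
`W 1 ≥ c′` and `W p₀ ≥ c′ + 1`: the `j = 1` surplus `c₀·c′·C(c₀, u−1)` pays the `j = 0` term `c′·C(c₀, u)`
(`choose_le_mul_choose_pred`) and the `j = p₀` surplus pays the `j = p₀+1` term (`choose_pred_le_mul_choose`).
* **`bprime_assembly`** — the inequality, in `ℕ`, for `2 ≤ p₀`, `1 ≤ u ≤ p₀ + c₀`.
Axioms: standard.
-/

namespace PercRepro

open Finset

/-- `C(c, u) ≤ c · C(c, u−1)` for `u ≥ 1`. -/
lemma choose_le_mul_choose_pred (c u : ℕ) (hu : 1 ≤ u) : c.choose u ≤ c * c.choose (u - 1) := by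
  obtain ⟨v, rfl⟩ : ∃ v, u = v + 1 := ⟨u - 1, by omega⟩
  have h := Nat.choose_succ_right_eq c v
  rw [Nat.add_sub_cancel]
  calc c.choose (v + 1) ≤ c.choose (v + 1) * (v + 1) := Nat.le_mul_of_pos_right _ (by omega)
    _ = c.choose v * (c - v) := h
    _ ≤ c.choose v * c := Nat.mul_le_mul_left _ (Nat.sub_le c v)
    _ = c * c.choose v := by ring

/-- `C(c, v−1) ≤ c · C(c, v)` for `1 ≤ v ≤ c`. -/
lemma choose_pred_le_mul_choose (c v : ℕ) (hv : 1 ≤ v) (hvc : v ≤ c) :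
    c.choose (v - 1) ≤ c * c.choose v := by
  obtain ⟨w, rfl⟩ : ∃ w, v = w + 1 := ⟨v - 1, by omega⟩
  have h := Nat.choose_succ_right_eq c w
  rw [Nat.add_sub_cancel]
  have hpos : 1 ≤ c - w := by omega
  calc c.choose w ≤ c.choose w * (c - w) := Nat.le_mul_of_pos_right _ hpos
    _ = c.choose (w + 1) * (w + 1) := h.symm
    _ ≤ c.choose (w + 1) * c := Nat.mul_le_mul_left _ (by omega)
    _ = c * c.choose (w + 1) := by ring

/-- **The arithmetic core of Theorem B′ (simple case, `r(E) = p`)**: if the level counts `W j` of a coloop-free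
part of rank `p₀` on `c′` points satisfy (L0) for `1 ≤ j ≤ p₀`, `W 1 ≥ c′` and `W p₀ ≥ c′ + 1`, then the
Vandermonde expansion of `C(p₀ + c₀ + 1, u)·c′` is dominated by `(p₀ + c₀ + 1)·Σ_{j ≤ u} W j · C(c₀, u − j)`
(the `j = 1` and `j = p₀` surpluses pay the `j = 0` and `j = p₀ + 1` terms). -/
lemma bprime_assembly (W : ℕ → ℕ) (p₀ c₀ c' u : ℕ) (hp₀ : 2 ≤ p₀) (hu1 : 1 ≤ u) (hup : u ≤ p₀ + c₀)
    (hL0 : ∀ j, 1 ≤ j → j ≤ p₀ → (p₀ + 1).choose j * c' ≤ (p₀ + 1) * W j)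
    (hW1 : c' ≤ W 1) (hWp : c' + 1 ≤ W p₀) :
    (p₀ + c₀ + 1).choose u * c' ≤
      (p₀ + c₀ + 1) * ∑ j ∈ Finset.range (u + 1), W j * c₀.choose (u - j) := by
  classical
  -- Vandermonde
  have hV : (p₀ + c₀ + 1).choose u =
      ∑ j ∈ Finset.range (u + 1), (p₀ + 1).choose j * c₀.choose (u - j) := by
    rw [show p₀ + c₀ + 1 = (p₀ + 1) + c₀ by ring, Nat.add_choose_eq,
      Finset.Nat.sum_antidiagonal_eq_sum_range_succ_mk]
  set B : ℕ → ℕ := fun j => (p₀ + 1).choose j * c' * c₀.choose (u - j) with hB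
  set A : ℕ → ℕ := fun j => (p₀ + c₀ + 1) * (W j * c₀.choose (u - j)) with hA
  have hgoalL : (p₀ + c₀ + 1).choose u * c' = ∑ j ∈ Finset.range (u + 1), B j := by
    rw [hV, Finset.sum_mul]
    exact Finset.sum_congr rfl (fun j _ => by simp only [hB]; ring)
  have hgoalR : (p₀ + c₀ + 1) * ∑ j ∈ Finset.range (u + 1), W j * c₀.choose (u - j) =
      ∑ j ∈ Finset.range (u + 1), A j := by
    rw [Finset.mul_sum]
  rw [hgoalL, hgoalR]
  -- the credited decomposition
  set B'' : ℕ → ℕ := fun j => if j = 0 ∨ j = p₀ + 1 then 0 else B j with hB''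
  set E : ℕ → ℕ := fun j =>
    (if j = 1 then B 0 else 0) + (if j = p₀ then (if p₀ + 1 ≤ u then B (p₀ + 1) else 0) else 0) with hE
  have hsplit : ∀ j, B j = B'' j + (if j = 0 then B 0 else 0) + (if j = p₀ + 1 then B (p₀ + 1) else 0) := by
    intro j
    simp only [hB'']
    by_cases h0 : j = 0
    · subst h0
      simp
    · by_cases h1 : j = p₀ + 1
      · subst h1
        simp
      · simp [h0, h1]
  have hsumB : ∑ j ∈ Finset.range (u + 1), B j =
      ∑ j ∈ Finset.range (u + 1), B'' j + B 0 + (if p₀ + 1 ≤ u then B (p₀ + 1) else 0) := by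
    rw [Finset.sum_congr rfl (fun j _ => hsplit j), Finset.sum_add_distrib, Finset.sum_add_distrib,
      Finset.sum_ite_eq', Finset.sum_ite_eq']
    simp only [Finset.mem_range]
    have h0 : 0 < u + 1 := by omega
    simp only [h0, if_true]
    congr 1
    by_cases h : p₀ + 1 ≤ u
    · simp [h, show p₀ + 1 < u + 1 by omega]
    · simp [h, show ¬ (p₀ + 1 < u + 1) by omega]
  have hsumE : ∑ j ∈ Finset.range (u + 1), E j = B 0 + (if p₀ + 1 ≤ u then B (p₀ + 1) else 0) := by
    simp only [hE]
    rw [Finset.sum_add_distrib, Finset.sum_ite_eq', Finset.sum_ite_eq']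
    simp only [Finset.mem_range]
    have h1 : 1 < u + 1 := by omega
    simp only [h1, if_true]
    congr 1
    by_cases h : p₀ + 1 ≤ u
    · simp [h, show p₀ < u + 1 by omega]
    · by_cases h' : p₀ < u + 1
      · simp [h, h']
      · simp [h, h']
  -- binomial facts used by the credits
  have hc1 : c₀.choose u ≤ c₀ * c₀.choose (u - 1) := choose_le_mul_choose_pred c₀ u hu1
  -- pointwise: `B'' j + E j ≤ A j`
  have hpt : ∀ j ∈ Finset.range (u + 1), B'' j + E j ≤ A j := by
    intro j hj
    rw [Finset.mem_range] at hj
    simp only [hB'', hE, hA, hB]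
    by_cases h0 : j = 0
    · subst h0
      simp [show (0 : ℕ) ≠ p₀ by omega]
    by_cases h1 : j = 1
    · subst h1
      have hne : (1 : ℕ) ≠ p₀ := by omega
      have hne' : ¬ ((1 : ℕ) = 0 ∨ 1 = p₀ + 1) := by omega
      simp only [hne, hne', if_false, if_true, add_zero, Nat.choose_one_right, Nat.choose_zero_right,
        one_mul]
      calc (p₀ + 1) * c' * c₀.choose (u - 1) + c' * c₀.choose u
          ≤ (p₀ + 1) * c' * c₀.choose (u - 1) + c' * (c₀ * c₀.choose (u - 1)) :=
            Nat.add_le_add_left (Nat.mul_le_mul_left _ hc1) _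
        _ = (p₀ + c₀ + 1) * (c' * c₀.choose (u - 1)) := by ring
        _ ≤ (p₀ + c₀ + 1) * (W 1 * c₀.choose (u - 1)) :=
            Nat.mul_le_mul_left _ (Nat.mul_le_mul_right _ hW1)
    by_cases hp : j = p₀
    · subst hp
      have hne' : ¬ ((j : ℕ) = 0 ∨ j = j + 1) := by omega
      simp only [hne', h1, if_false, if_true, zero_add, Nat.choose_succ_self_right]
      -- `(p₀+1)·c′·C(c₀,u−p₀) + [p₀+1 ≤ u]·c′·C(c₀,u−p₀−1) ≤ (p₀+c₀+1)·W p₀·C(c₀,u−p₀)`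
      have hmain : (j + 1) * c' * c₀.choose (u - j) + c₀ * c' * c₀.choose (u - j) ≤
          (j + c₀ + 1) * (W j * c₀.choose (u - j)) := by
        calc (j + 1) * c' * c₀.choose (u - j) + c₀ * c' * c₀.choose (u - j)
            = (j + c₀ + 1) * (c' * c₀.choose (u - j)) := by ring
          _ ≤ (j + c₀ + 1) * (W j * c₀.choose (u - j)) :=
            Nat.mul_le_mul_left _ (Nat.mul_le_mul_right _ (by omega))
      by_cases hle : j + 1 ≤ u
      · simp only [hle, if_true, Nat.choose_self, one_mul]
        have hv : c₀.choose (u - (j + 1)) ≤ c₀ * c₀.choose (u - j) := by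
          have := choose_pred_le_mul_choose c₀ (u - j) (by omega) (by omega)
          rwa [show u - j - 1 = u - (j + 1) by omega] at this
        calc (j + 1) * c' * c₀.choose (u - j) + c' * c₀.choose (u - (j + 1))
            ≤ (j + 1) * c' * c₀.choose (u - j) + c' * (c₀ * c₀.choose (u - j)) :=
              Nat.add_le_add_left (Nat.mul_le_mul_left _ hv) _
          _ = (j + 1) * c' * c₀.choose (u - j) + c₀ * c' * c₀.choose (u - j) := by ring
          _ ≤ _ := hmain
      · simp only [hle, if_false, add_zero]
        exact le_trans (Nat.le_add_right _ _) hmain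
    by_cases hp1 : j = p₀ + 1
    · subst hp1
      simp [show p₀ ≠ 0 by omega]
    -- the remaining `j`: `2 ≤ j ≤ p₀ − 1` by (L0), or `j ≥ p₀ + 2` where `B j = 0`
    have hne' : ¬ (j = 0 ∨ j = p₀ + 1) := by omega
    simp only [hne', h1, hp, if_false, add_zero]
    by_cases hjp : j ≤ p₀
    · have h := hL0 j (by omega) hjp
      calc (p₀ + 1).choose j * c' * c₀.choose (u - j)
          ≤ (p₀ + 1) * W j * c₀.choose (u - j) := Nat.mul_le_mul_right _ h
        _ ≤ (p₀ + c₀ + 1) * W j * c₀.choose (u - j) :=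
            Nat.mul_le_mul_right _ (Nat.mul_le_mul_right _ (by omega))
        _ = (p₀ + c₀ + 1) * (W j * c₀.choose (u - j)) := by ring
    · rw [Nat.choose_eq_zero_of_lt (by omega)]
      simp
  calc ∑ j ∈ Finset.range (u + 1), B j
      = ∑ j ∈ Finset.range (u + 1), B'' j + ∑ j ∈ Finset.range (u + 1), E j := by
        rw [hsumB, hsumE]; ring
    _ = ∑ j ∈ Finset.range (u + 1), (B'' j + E j) := (Finset.sum_add_distrib).symm
    _ ≤ ∑ j ∈ Finset.range (u + 1), A j := Finset.sum_le_sum hpt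


end PercRepro
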